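import Mathlib
import HarnessLib
import HarnessLib.Audit
import Summits.CriticalPhenomena.Statement
import Literature.Probability.RandomPlanarGeometry.ChordalCurveFamily
import Literature.Probability.RandomPlanarGeometry.SelfAvoidingWalk
import Summits.CriticalPhenomena.SAWScalingLimit.Theorems.SAWPoissonBanksLSWSimpleRestrictionIsSLE
import HarnessLib.Audit.Status.Attr

/-!
Route: SAWExpCovariance

# Route SAWExpCovariance — one map is enough — exp-covariance of the ℤ² SAW limit plus a soft
density theorem give full conformal invariance

It suffices to show X = EXP ∧ DC ∧ DENS ∧ AX ∧ LIM (route realising idea card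
exp-one-map-density-theorem — "one map is
enough"). LIM (shared, stmt-CriticalPhenomena-1371): the critical δℤ² SAW has a full scaling limit P
as a chordal curve family
(P chordal with (lim): for every Dobrushin domain and EVERY endpoint approximation the
pushed-forward SAW laws converge weakly to P D — literally the body of `SAW.IsScalingLimitFamily`,
inlined). AX: every such P has exact two-sided restriction, translation + dilation covariance and is
carried by
simple boundary-avoiding chords. EXP (the ONE embedding-sensitive lattice crux): every such P is
covariant under the exponential map
on every Dobrushin domain U on whose closure exp is injective — P(exp U; e^p, e^q) = exp_* P(U; p,
q) ("the critical SAW cannot tell a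
rolled-up strip read in polar coordinates from a flat annular sector": rectangles =
row-transfer-matrix domains, their exp-images =
Baxter corner-transfer-matrix domains). DC: P is continuous along conformal images of the disc
converging uniformly on the CLOSED
disc (Radó/Fréchet continuity in (∂D, a, b)). DENS (continuum, new but soft): a chordal family with
translation + dilation
covariance, EXP and DC is covariant under ALL conformal maps — rotations are vertical translations
of log-coordinates
(exp∘T_iα∘log), Möbius/powers/roots are exp∘(c·)∘log, and Loewner chains with piecewise-constant
driving put every Riemann map in
the closure. Then LSW03 p. 5 result 2 (restriction + conformal covariance + simple ⇒ chordal
SLE_8/3) identifies P — it enters as the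
SHARED hypothesis-free support item LSWRestrictionFact83 (stmt-CriticalPhenomena-3017, wanted by
nine other SAW routes; provable now in
one line by the in-tree theorem `LawlerSchrammWerner2003_holds`, ConformalRestrictionHolds.lean) —
and the conjunct follows by the
two-line `integral_map` argument (as in `SAW.IsScalingLimitFamily.sawScalingLimit`) inside the
deciding theorem `closes`.
Lean: `ExpCovariance ∧ DiscContinuity ∧ DensityTheorem ∧ LimitAxioms ∧ LimitExists`

## Assembly
The deciding theorem `closes : ExpCovariance → DiscContinuity → DensityTheorem → LimitAxioms →
LimitExists → CarrierDependence →
LSWRestrictionFact83 → SAWScalingLimit` (glue.lean, 13 lines of logic over the tree, certified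
sorry-free, axioms propext /
Classical.choice / Quot.sound): take P, chordal with (lim), from LimitExists; LimitAxioms gives
restriction, translation/dilation
covariance and simplicity; CarrierDependence gives carrier-dependence; ExpCovariance and
DiscContinuity feed DensityTheorem, which
returns `P.IsConformallyCovariant`; LSWRestrictionFact83 (LSW03 p. 5 result 2 at κ = 8/3,
hypothesis-free) gives `IsSLELaw (8/3) D (P D)`
for every D; `integral_map` + `SAW.aemeasurable_curve` turn (lim) into `ConvergesInLawToSLE (8/3)`,
i.e. SAWScalingLimit. The `Assembly`
item is exactly this implication and closes at once by the term `closes`; RotationsFromExp (support,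
first step of DENS) stays a
route item but is no longer a hypothesis of `closes` (rev 1 carried it unused).
Cone repair 2026-08-15 (needs-fact: none). Rev 1 called the proved theorem
`LawlerSchrammWerner2003_holds` INSIDE `closes`, which forced on the
route file the header line `Literature.Probability.RandomPlanarGeometry.ConformalRestrictionHolds`:
that single line drags in the
458-module LSW03 proof chain and, with it, 36 unproved named facts that nothing in this route uses
(SLE(κ,ρ) fills and one-sided martingales, Brownian and
SLE bubble measures, `exists_isRestrictionMeasure_iff`, the SLE₈ trace theorem
`LawlerSchrammWerner2004_thm47`, SLE₆ locality / SLE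
dimension / space-filling facts of CritPercSLE, `ito_formula_itoProcess`, …) into the route's module
cone, and the staffing guardrail
blocked the route although its declaration-level cone was already clean (0 unproved deps of 93
project constants). Rev 2 moves the LSW03
step onto the shared item stmt-3017 (as SAWRestrictionRigidity / SAWInfinitesimalRigidity do), so
the route file is built only on
ChordalCurveFamily and SelfAvoidingWalk — both inside the sub-problem Statement's own module cone —
and none of the 36 facts remains.
Caveat for the next repair seat / operator: when stmt-3017 is proved, its Theorems file has to be
built on ConformalRestrictionHolds, and the
gate's `_holds` link will re-introduce that chain into every one of the ten route files wanting it;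
at that point the honest fix is
header hygiene inside Literature/Probability/RandomPlanarGeometry (keep unproved named facts out of
the files on which the LSW03
proof chain is built) or declaration-level cone accounting (`#h21_route_deps`), not another
restatement here.

Rationale: WHY THIS LINE. Beffara2008Universal (arXiv:0708.3908 §2) shows that embedding-blind arguments leave
a linear modulus free, so SOME embedding-sensitive
lattice input is unavoidable; this line concentrates ALL of it into covariance under one explicit
non-Möbius map, exp, between the
two ℤ²-friendliest geometries (Cardy1984's logarithmic map strip ↔ plane/annulus; row vs corner
transfer matrices, Thacker1986), and
makes everything else soft: by the Lie–Cartan list of transitive holomorphic pseudogroups in one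
variable (translations ⊂ affine ⊂
projective ⊂ all) adjoining exp to the affine maps generates a dense pseudogroup, and DENS turns
that folklore into a measure-level
theorem using only Loewner slit dynamics (elementary maps are words in affine, 1/z, z², √z =
exp∘c∘log), the Riemann mapping and
Carathéodory theorems (both PROVED in the tree: `exists_conformalEquiv_ball_holds`,
`JordanDomain.continuousOn_extendFrom'`) and DC.
Imported areas: geometric function theory (Loewner–Kufarev approximation, Radó's theorem
PommerenkeBBCM1992 Thm 2.11) and Lie
pseudogroup density; the closing is conformal restriction (LawlerSchrammWerner2003Restriction, p. 5
result 2 — PROVED in the tree as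
`LawlerSchrammWerner2003_holds`; it enters the deciding theorem `closes` as the shared
hypothesis-free support item LSWRestrictionFact83,
stmt-CriticalPhenomena-3017, so that the route file stays clear of the LSW03 proof chain's modules —
cone repair 2026-08-15). Law-level single-map covariance of
the planar SAW has numerical support (Kennedy2002, Kennedy2004: SLE_8/3 predictions incl. cut-plane
vs half-plane). Versus the open
routes: SAWConfRestriction ASSUMES full conformal covariance of the limit; SAWRestrictionRigidity
bets on a rigidity conjecture R* with
NO map beyond the quarter-turn (and needs the restriction-coupled Markov passage); here one map is
taught to the walk and the upgrade
is a theorem, with no Markov property, no observable, no integrability.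

RANKED CRUXES. #2 ExpCovariance (crux) — EXP of the card, at the level of the full limit: for every
scaling-limit family P of the critical δℤ² SAW (P chordal with (lim), the inlined body of
`SAW.IsScalingLimitFamily`) and every Dobrushin domain U with exp injective on closure U, and every
Dobrushin V with carrier exp(U) and marked points e^p, e^q, P V = (P U).map (CurveClass.map exp).
Rectangles of height < 2π ↦ annular sectors is the row-vs-corner transfer-matrix case; log(D − c) ↦
D − c gives rotations. [deps: LimitExists] [difficulty: open-problem] (why it might fail: It carries
the whole conformal content of the conjunct in one map: straight vs circular/radial lattice
boundaries near e^p, e^q must not bias the normalised LAW (Kennedy–Lawler effects hit partition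
functions); no tool compares row- and corner-transfer limits of a non-integrable model.)
[Kennedy2004, Kennedy2002, KennedyLawler2013, Cardy1984, Thacker1986, Beffara2008Universal,
doi:10.1088/0305-4470/18/1/022]
#3 DiscContinuity (crux) — domain continuity of the SAW limit in the Radó/Fréchet sense: if Φ_n, Φ :
ℂ → ℂ are continuous, agree on the unit disc with conformal equivalences onto Dobrushin domains D_n,
D whose marked points are Φ_n(∓1), Φ(∓1), and Φ_n → Φ uniformly on the CLOSED disc, then P D_n → P D
weakly, for every scaling-limit family P. True for the SLE_8/3 family (pushforward continuity), so
implied by the conjunct; it is the only continuity DENS consumes. [deps: LimitExists] [difficulty: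
open-problem] (why it might fail: Needs uniform-in-δ stability of the normalised SAW law under
C⁰-small conformal perturbations of the closed domain AT the marked points (no-crawling /
boundary-avoidance estimates near a_δ, b_δ not in print); thin fjords near a could trap macroscopic
mass.) [PommerenkeBBCM1992, KennedyLawler2013, DuminilCopinHammond2013, LawlerSchrammWerner2004SAW]
#4 DensityTheorem (crux) — DENS (continuum, no lattice): a chordal family P on Dobrushin domains
that is chordal, depends on D only through (carrier, a, b), is covariant under translations and
positive dilations, is exp-covariant on every Dobrushin U with exp injective on closure U, and is
disc-continuous (as in DiscContinuity) is conformally covariant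
(`ChordalFamily.IsConformallyCovariant`). Plan: rotations = exp∘T_iα∘log on log(D − c); 1/z, z², √z
= exp∘(c·)∘log on Jordan domains compactly inside their slit regions; radial Loewner chains with
piecewise-constant driving approximate any Riemann map ψ locally uniformly on the open disc by such
words g_N univalent on 𝔻; Φ_N(z) = g_N(r_N z) → ψ uniformly on the closed disc by Carathéodory
continuity (tree); DC + pushforward continuity give ψ ∈ 𝒢; g = ψ'∘ψ⁻¹. [difficulty: L] (why it might
fail: Bookkeeping may need more than stated: each Loewner word must map the current closed Jordan
domain homeomorphically onto a Jordan domain, exp-injective on closures at every exp step; a hidden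
use of restriction/positivity or of continuity beyond disc images would alter the hypotheses.)
[PommerenkeBBCM1992, LoewnerNirenberg1974, Beffara2008Universal, doi:10.1112/plms/s3-64.2.339]
#5 LimitAxioms (crux) — AX: every scaling-limit family P of the critical δℤ² SAW has the two-sided
restriction property (`ChordalFamily.IsRestriction`; exact lattice identity LSW04 §3.4.5 passed to
the limit), is covariant under z ↦ r z + w (r > 0, w ∈ ℂ: (λΩ)_δ = λΩ_(δ/λ) and axis-parallel
lattice translations along δ_n = |w|/n, exact for the FULL limit), and is carried by simple chords
meeting ∂D only at a, b. A sub-bundle of AxiomsOfLimit of route SAWRestrictionRigidity (no Markov,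
no reversal, no D4 needed here). [deps: LimitExists] [difficulty: open-problem] (why it might fail:
Restriction passage needs null touching of ∂D' by the limit; simplicity and boundary avoidance of
SAW subsequential limits need no-crawling estimates at x_c that are not in print (only believed via
SLE_8/3).) [LawlerSchrammWerner2004SAW, DuminilCopinHammond2013, KennedyLawler2013, Werner2007]
#6 LimitExists (crux) — LIM (shared verbatim with route SAWRestrictionRigidity,
stmt-CriticalPhenomena-1371): the critical δℤ² SAW laws have a full scaling limit as a chordal curve
family — ∃ P chordal with (lim) for every Dobrushin domain and every endpoint approximation (value
not identified). [difficulty: open-problem] (why it might fail: Eventual tightness of the critical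
SAW is open (no annulus-crossing bound at x_c); uniqueness of subsequential limits is a further
scalar input; an approximation-dependent limit would refute the conjunct itself.)
[LawlerSchrammWerner2004SAW, KemppainenSmirnov2017, AizenmanBurchardDuke1999,
DuminilCopinHammond2013]
#9 CarrierDependence (support) — glue, provable now: a scaling-limit family P (chordal with (lim))
sees a Dobrushin domain only through (carrier, a, b) — the boundary parametrisation is invisible to
the lattice model. Closes by citing `SAW.IsScalingLimitFamily.apply_eq_of_carrier_eq`
(SAWScalingLimitFamily.lean, proved: weak limits along 𝓝[>]0 are unique and endpoint approximations
exist) once that module is built on the farm; inlined here to keep the route file's module cone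
built. [difficulty: provable-now] [LawlerSchrammWerner2004SAW]
#9 RotationsFromExp (support) — the first and most wanted step of DENS in isolation, provable now:
chordal + carrier-determined + translation/dilation covariant + exp-covariant ⇒ covariant under ALL
similarities z ↦ c z + w, c ∈ ℂ* (`ChordalFamily.IsSimilarityCovariant`): with c ≪ 0 real so that D
− c lies in the right half-plane, R_α = T_c ∘ exp ∘ T_iα ∘ Log ∘ T_(−c) on D (principal Log; both
exp steps injective on closures since heights < π), other centres by R^c_α = T_w ∘ R_α. "Rotations
are vertical translations of the rectangle." [difficulty: provable-now] [Beffara2008Universal,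
Cardy1984]
#9 LSWRestrictionFact83 (support) — the LSW03 identification step as the SHARED hypothesis-free item
stmt-CriticalPhenomena-3017 (verbatim; wanted by SAWRestrictionRigidity, SAWInfinitesimalRigidity
and seven more SAW routes): chordal + conformally covariant (`ChordalFamily.IsConformallyCovariant`)
+ two-sided restriction (`ChordalFamily.IsRestriction`) + simple boundary-avoiding ⇒ every P D is
the chordal SLE_{8/3} law (`IsSLELaw (8/3)`); LSW03 p. 5 result 2 with Prop. 3.3, Thm 6.1, Cor. 8.6.
Provable now in one line by `LawlerSchrammWerner2003_holds` in a Theorems file built on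
ConformalRestrictionHolds — a module kept out of THIS file on purpose (cone repair 2026-08-15: it
alone carried the 36 collateral unproved named facts of the 458-module LSW03 proof chain into the
route's module cone; needs-fact: none). [difficulty: provable-now]
[LawlerSchrammWerner2003Restriction, arXiv:math/0209343]

TWO-LAYER PLAN. Foreseen glued splits (none filed now): DensityTheorem ⇐ RotationsFromExp-type step
(all similarities + 1/z, z², √z as words) →
LoewnerWordApproximation (piecewise-constant radial Loewner words g_N univalent on 𝔻 converge
locally uniformly to any normalised
Riemann map) → DensityTheorem (closure step: Carathéodory + DC + pushforward continuity).
ExpCovariance ⇐ ExpThinRegime (rectangles of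
aspect ratio ≥ L₀ ↦ thin sectors: the quasi-1D row-vs-corner transfer-operator comparison, the
card's first sub-target) → ExpAllShapes
(restriction-exact bootstrapping from long rectangles to all exp-injective domains, which needs AX +
positivity of corridor events) →
ExpCovariance. LimitExists ⇐ EventualTight (stmt-1372) → uniqueness of subsequential limits →
LimitExists (as planned in
SAWRestrictionRigidity; shared).

KILL CRITERIA. ¬ExpCovariance (a full limit exists but is not exp-covariant on some rectangle/sector
pair) refutes the conjunct SAWScalingLimit
itself as typed (the SLE_8/3 family is exp-covariant) — close `refuted:ExpCovariance` and file the
witness as a barrier; likewise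
¬DiscContinuity or ¬LimitAxioms exhibit a non-SLE limit. ¬DensityTheorem by an explicit
translation/dilation/exp-covariant,
disc-continuous, NOT conformally covariant chordal family is route-specific: pivot once by adding
restriction + positivity of
sub-domain events to the hypotheses (the card's original (b)); a second counterexample closes the
route `refuted:DensityTheorem`.
Rigidity (stmt-1368) proved elsewhere makes EXP a corollary-level check and this route `superseded`
by SAWRestrictionRigidity;
conversely ¬Rigidity leaves this line as the fallback.

NOT DECOMPOSED YET. The thin-regime (long rectangle ↦ thin sector) form of EXP and its
transfer-operator formulation (corner transfer matrix of the ℤ²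
SAW as a positive operator on arc-cut states — definition-level bookkeeping, `SAWStripTM` exists for
rows); positivity of corridor
events needed to bootstrap EXP from one aspect class by restriction; the Loewner-word lemma and the
image-domain constructions inside
DENS; tightness / uniqueness children of LimitExists (shared with SAWRestrictionRigidity). All are
layer-2 children, filed only when a
crux closes or stalls with a census.

CHEAPEST FALSIFIER. For DENS: check Step 1 by hand — with D − c in the right half-plane,
T_c∘exp∘T_iα∘Log∘T_(−c) IS the rotation by α about c′ and
each factor is admissible (heights < π): if this failed the whole reduction would be void (it does
not; RotationsFromExp is filed
provable-now as the executable version). For EXP: the scalar shadow "wedge exponent × angle = strip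
decay rate" is the 1984 numerics
(Cardy–Redner, Guttmann–Torrie; μ_wedge = μ rigorous, Hammersley–Whittington
doi:10.1088/0305-4470/18/1/022) and passed; the law-level
Monte Carlo of Kennedy2002/Kennedy2004 (half-plane and cut-plane SAW vs SLE_8/3, i.e. covariance
under z ↦ √z = exp∘½∘log) also
passed at the per-mille level. The cheapest NEW check is a kit Monte Carlo (variable-length
Berretti–Sokal SAW at x_c) comparing the
crossing-height law of exp(walk in [0,3]×[0,3]) with the radial-crossing law in the sector (1,
e³)×(0, 3 rad); not run here (kit not in
this seat's remit).

NUMBERS. x_c = 1/μ, μ(ℤ²) ≈ 2.63815853 (tree: 2.6 ≤ μ ≤ 2.7,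
`LawlerSchrammWerner2004SAW_connectiveConstant_bounds`); boundary exponent 5/8 and
κ = 8/3 (LSW03 α = 5/8); admissible strip height for exp-injectivity < 2π; items: 9 at open, 8 after
the glue repair, 9 after the cone repair of 2026-08-15 (5 cruxes, 3 support, 1 assembly; LimitExists
=
stmt-CriticalPhenomena-1371 and LSWRestrictionFact83 = stmt-CriticalPhenomena-3017 shared verbatim;
the `exists_isSLECurve`-guarded stmt-0775
stays dropped; the deciding theorem `closes` takes the 5 cruxes + CarrierDependence +
LSWRestrictionFact83 as hypotheses (RotationsFromExp is an
item but not a hypothesis) and the restated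
Assembly is closed by the term `closes`; route-level header modules: ChordalCurveFamily,
SelfAvoidingWalk only — module cone ⊆ the Statement's own, 0 of
the 36 formerly listed unproved facts; declaration-level cone 0 unproved).

DEFINITION REQUESTS. None needed to state the items (ChordalFamily, IsConformallyCovariant,
IsRestriction, IsSimilarityCovariant, similarity, MarkedDomain.map,
ConformalEquiv, SAW.law / IsEndpointApprox / TendstoLaw, CurveClass.map / simple all exist;
`SAW.IsScalingLimitFamily` exists but its module is
not yet built on the farm, so its body is inlined verbatim, matching LimitExists). Nice-to-have
later (not filed): `MarkedDomain.imageOfInjOn` (image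
Dobrushin domain under a map injective and continuous on the closure) and the annular-sector /
rectangle Dobrushin constructors, which
DENS provers will build in Theorems/ with `--supports DensityTheorem`.

Novelty: Searches (2026-08-15): `lit search --hybrid "conformal invariance self-avoiding walk Monte Carlo
test exponential map cut plane
Kennedy"` (8 local docs: Lawler 2005, Madras–Slade 1993, Guttmann (ed.) Polygons…; none on
single-map reductions); `lit search --hybrid
"Radó theorem … Jordan curves converge"` → PommerenkeBBCM1992 Thm 2.11 read (PDF p.35); `lit search
--source crossref` for Kennedy's
tests (doi:10.1023/b:joss.0000003104.35024.f9, doi:10.1103/physrevlett.88.130601), SAW in wedges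
(doi:10.1088/0305-4470/18/1/022,
Janse van Rensburg 2015 ch.8), CTM/Lorentz (doi:10.1016/0167-2789(86)90196-x,
doi:10.1103/physrevlett.58.1395); `lit galaxy search
--star all` ×4 ("conformal invariance from exponential map", "self-avoiding walk in an annulus
sector", "corner transfer matrix
self-avoiding", "walks in a wedge": 0 hits each); openalex/s2 rate-limited (429), zbMATH 0; plus the
card's searches and the refuter
novelty audit of 2026-08-15 (grade new-combination; prior art Lie–Cartan/Olver 1995, Thacker 1986,
Kennedy 2004).
Nearest prior art found: Kennedy2004 (doi:10.1023/b:joss.0000003104.35024.f9: law-level Monte Carlo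
of single-map SLE_8/3
predictions for the SAW, no reduction theorem); Cardy1984 (logarithmic map, scalar finite-size
level); Beffara2008Universal
(arXiv:0708.3908: why an embedding-sensitive input is needed); Lie–Cartan pseudogroup classification
(doi:10.1112/plms/s3-64.2.339,
González-López–Kamran–Olver) = substance of the density step; LawlerSchrammWerner2003Rest  [refs: 10.1023/b:joss.0000003104.35024.f9, 10.1103/physrevlett.88.130601, 10.1088/0305-4470/18/1/022, 10.1016/0167-2789(86, 10.1103/physrevlett.58.1395, 10.1023/b:joss.0000003104.35024.f9:, 10.1112/plms/s3-64.2.339, 0708.3908, math/0209343, doi:10.1023/b, doi:10.1103/physrevlett.88.130601, doi:10.1088/0305-4470/18/1/022, doi:10.1016/0167-2789, doi:10.1103/physrevlett.58.1395, doi:10.1112/plms/s3-64.2.339]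

Barriers (technique_class: single-map-reduction density-theorem row-vs-corner): - technique_class: single-map-reduction density-theorem row-vs-corner
- Literature.Barriers.CriticalPhenomena.EmbeddingModulusUniqueness: met head-on, not evaded — EXP is
embedding-sensitive (false for a sheared lattice: exp of a sheared rectangle grid is not the sheared
lattice's sector) and is the route's single lattice-specific input; rotations are DERIVED
(RotationsFromExp), consistent with Beffara2008Universal Prop. 4.
- Literature.Barriers.CriticalPhenomena.ScaleCovarianceNotMoebius: the upgrade is not "scale ⇒
conformal": DENS assumes covariance under a non-Möbius map (exp), exactly the datum the barrier's
witness family lacks; its d = 3 correlation witness is outside the class of planar chordal curve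
families anyway.
- Literature.Barriers.CriticalPhenomena.NienhuisWeightsExcludeVertexSAW: no O(n)/parafermionic
weights or Yang–Baxter are used; the corner transfer matrix enters only as motivation (a positive
operator), never through integrability — honest caveat: nothing is known about the ℤ² SAW's CTM
spectrum, so the dictionary motivates EXP, it proves nothing.
- Literature.Barriers.CriticalPhenomena.FKParafermionicHalfCauchyRiemann: n/a (no discrete
observable).
- Literature.Barriers.CriticalPhenomena.SmirnovTriangularOnly: n/a (no percolation input).
- Negatives index: stmt-CriticalPhenomena-0772 (all-δ tightness, refuted by
SAWParafermionTight_refuted) is not wanted — LimitExists is the ∃-limit form and tightness enters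
only eventually, as in stmt-1372; no other re

Novelty grade: new-combination — refuter route-review (rreview-6e240eb2) 2026-08-15 — route novelty = the realised card's audited grade (exp-one-map-density-theorem: NEW-COMBINATION, refuter-novelty-audit-CriticalPhenomena-SAWScalingLimit-8-0, 07:09Z), re-read against the route as filed: [Lie–Cartan density of the pseudogroup gener (refuter refuter-rreview-route-CriticalPhenomena--6e240eb2-0, 2026-08-15T13:59:14Z; prior: Olver1995/SingerSternberg1965 (Lie–Cartan pseudogroup classification); doi:10.1088/0305-4470/17/7/003 (Cardy 1984 wedge/log map); doi:10.1016/0167-2789(86)90196-x (Thacker 1986 CTM); arXiv:math/0209343 (LSW03); Kennedy2002/Kennedy2004 (SAW vs SLE8/3 numerics); arXiv:0708.3908 (Beffara))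

History (route lifecycle, newest last):
- 2026-08-15T16:18:44Z · rev 1: restated Assembly (stmt-CriticalPhenomena-6760) — glue repair (route-repair seat, 2026-08-15): deciding theorem `closes : ExpCovariance → DiscContinuity → DensityTheorem → LimitAxioms → LimitExists → CarrierDep (planner-rbadge-CriticalPhenomena-SAWExpCovaria-379aca35-g4-0)
- 2026-08-15T16:18:44Z · rev 1: dropped LSWRestrictionFact — glue repair (route-repair seat, 2026-08-15): deciding theorem `closes : ExpCovariance → DiscContinuity → DensityTheorem → LimitAxioms → LimitExists → CarrierDep (planner-rbadge-CriticalPhenomena-SAWExpCovaria-379aca35-g4-0)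
- 2026-08-15T16:53:29Z · rev 2: restated Assembly (stmt-CriticalPhenomena-10578) — cone repair 2/2 (route-repair seat 2026-08-15): deciding theorem `closes` now takes the shared hypothesis-free LSW03 item LSWRestrictionFact83 (stmt-CriticalPhe (planner-rrepair-CriticalPhenomena-SAWExpCovari-379aca35-0)
- 2026-08-15T17:27:19Z · rev 8: restated Assembly (stmt-CriticalPhenomena-11200) — cone repair, final: drop the unused hypothesis RotationsFromExp from the deciding theorem (it stays a support item) and restate Assembly to the exact type of `c (planner-rrepair-CriticalPhenomena-SAWExpCovari-379aca35-0)

sub-problem: SAWScalingLimit · status: open · opened planner-plancard-CriticalPhenomena-SAWScaling-e8c4aff1-0 2026-08-15T11:51:52Z · rev 8 · ledger route-CriticalPhenomena-SAWExpCovariance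
GENERATED by the gate from the ledger (D-0016/17). Provers cite these decls: `theorem foo : Summit.CriticalPhenomena.SAWScalingLimit.Theses.SAWExpCovariance.<Decl> := …` in Summits/CriticalPhenomena/SAWScalingLimit/Theorems/<Name>.lean.
-/

namespace Summit.CriticalPhenomena.SAWScalingLimit.Theses.SAWExpCovariance

open scoped BigOperators Topology Manifold Classical MeasureTheory ProbabilityTheory Matrix InnerProductSpace ComplexConjugate ContinuousMap
open Filter Set Function TopologicalSpace MeasureTheory

attribute [summit_statement] _root_.SAWScalingLimit

/-- item stmt-CriticalPhenomena-6754 · crux · rank 2 · open · by planner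
why it might fail: It carries the whole conformal content of the conjunct in one map: straight vs circular/radial lattice boundaries near e^p, e^q must not bias the normalised LAW (Kennedy–Lawler effects hit partition functions); no tool compares row- and corner-transfer limits of a non-integrable model.
sources: Kennedy2004, Kennedy2002, KennedyLawler2013, Cardy1984, Thacker1986, Beffara2008Universal
[crux] EXP of the card, at the level of the full limit: for every scaling-limit family P of the
critical δℤ² SAW (P chordal with (lim), the inlined body of `SAW.IsScalingLimitFamily`) and every
Dobrushin domain U with exp injective on closure U, and every Dobrushin V with carrier exp(U) and
marked points e^p, e^q, P V = (P U).map (CurveClass.map exp). Rectangles of height < 2π ↦ annular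
sectors is the row-vs-corner transfer-matrix case; log(D − c) ↦ D − c gives rotations. [deps:
LimitExists] [difficulty: open-problem] -/
@[route_item "route-CriticalPhenomena-SAWExpCovariance", crux]
def ExpCovariance : Prop :=
  ∀ P : Literature.Probability.RandomPlanarGeometry.ChordalFamily, P.IsChordal → (∀ (D : Literature.Probability.RandomPlanarGeometry.DobrushinDomain) (a b : ℝ → Literature.Probability.LatticeModels.Site 2), Literature.Probability.RandomPlanarGeometry.SAW.IsEndpointApprox D a b → Literature.Probability.RandomPlanarGeometry.TendstoLaw (fun δ (γ : Literature.Probability.RandomPlanarGeometry.SAW.DomainSAW D.carrier δ (a δ) (b δ)) => γ.curve) (fun δ => Literature.Probability.RandomPlanarGeometry.SAW.law D.carrier δ (a δ) (b δ)) id (P D)) → ∀ (U V : Literature.Probability.RandomPlanarGeometry.DobrushinDomain), Set.InjOn Complex.exp (closure U.carrier) → V.carrier = Complex.exp '' U.carrier → V.pt 0 = Complex.exp (U.pt 0) → V.pt 1 = Complex.exp (U.pt 1) → P V = (P U).map (Literature.Probability.RandomPlanarGeometry.CurveClass.map (⟨Complex.exp, Complex.continuous_exp⟩ : C(ℂ,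 ℂ)))

/-- item stmt-CriticalPhenomena-6755 · crux · rank 3 · open · by planner
why it might fail: Needs uniform-in-δ stability of the normalised SAW law under C⁰-small conformal perturbations of the closed domain AT the marked points (no-crawling / boundary-avoidance estimates near a_δ, b_δ not in print); thin fjords near a could trap macroscopic mass.
sources: PommerenkeBBCM1992, KennedyLawler2013, DuminilCopinHammond2013, LawlerSchrammWerner2004SAW
[crux] domain continuity of the SAW limit in the Radó/Fréchet sense: if Φ_n, Φ : ℂ → ℂ are
continuous, agree on the unit disc with conformal equivalences onto Dobrushin domains D_n, D whose
marked points are Φ_n(∓1), Φ(∓1), and Φ_n → Φ uniformly on the CLOSED disc, then P D_n → P D weakly,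
for every scaling-limit family P. True for the SLE_8/3 family (pushforward continuity), so implied
by the conjunct; it is the only continuity DENS consumes. [deps: LimitExists] [difficulty:
open-problem] -/
@[route_item "route-CriticalPhenomena-SAWExpCovariance", crux]
def DiscContinuity : Prop :=
  ∀ P : Literature.Probability.RandomPlanarGeometry.ChordalFamily, P.IsChordal → (∀ (D : Literature.Probability.RandomPlanarGeometry.DobrushinDomain) (a b : ℝ → Literature.Probability.LatticeModels.Site 2), Literature.Probability.RandomPlanarGeometry.SAW.IsEndpointApprox D a b → Literature.Probability.RandomPlanarGeometry.TendstoLaw (fun δ (γ : Literature.Probability.RandomPlanarGeometry.SAW.DomainSAW D.carrier δ (a δ) (b δ)) => γ.curve) (fun δ => Literature.Probability.RandomPlanarGeometry.SAW.law D.carrier δ (a δ) (b δ)) id (P D)) → ∀ (Dn : ℕ → Literature.Probability.RandomPlanarGeometry.DobrushinDomain) (D : Literature.Probability.RandomPlanarGeometry.DobrushinDomain) (Φn : ℕ → C(ℂ, ℂ)) (Φ : C(ℂ, ℂ)), (∀ n, ∃ g : Literature.Probability.RandomPlanarGeometry.ConformalEquiv (Metric.ball (0 : ℂ) 1) (Dn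 n).carrier, Set.EqOn (Φn n) g (Metric.ball (0 : ℂ) 1)) → (∃ g : Literature.Probability.RandomPlanarGeometry.ConformalEquiv (Metric.ball (0 : ℂ) 1) D.carrier, Set.EqOn Φ g (Metric.ball (0 : ℂ) 1)) → (∀ n, (Dn n).pt 0 = Φn n (-1) ∧ (Dn n).pt 1 = Φn n 1) → D.pt 0 = Φ (-1) → D.pt 1 = Φ 1 → TendstoUniformlyOn (fun n => ((Φn n : C(ℂ, ℂ)) : ℂ → ℂ)) (Φ : ℂ → ℂ) Filter.atTop (Metric.closedBall (0 : ℂ) 1) → ∀ f : BoundedContinuousFunction (Literature.Probability.RandomPlanarGeometry.CurveClass ℂ) ℝ, Filter.Tendsto (fun n => ∫ γ, f γ ∂(P (Dn n))) Filter.atTop (nhds (∫ γ, f γ ∂(P D)))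

/-- item stmt-CriticalPhenomena-6756 · crux · rank 4 · open · by planner
why it might fail: Bookkeeping may need more than stated: each Loewner word must map the current closed Jordan domain homeomorphically onto a Jordan domain, exp-injective on closures at every exp step; a hidden use of restriction/positivity or of continuity beyond disc images would alter the hypotheses.
sources: PommerenkeBBCM1992, LoewnerNirenberg1974, Beffara2008Universal, doi:10.1112/plms/s3-64.2.339
[crux] DENS (continuum, no lattice): a chordal family P on Dobrushin domains that is chordal,
depends on D only through (carrier, a, b), is covariant under translations and positive dilations,
is exp-covariant on every Dobrushin U with exp injective on closure U, and is disc-continuous (as in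
DiscContinuity) is conformally covariant (`ChordalFamily.IsConformallyCovariant`). Plan: rotations =
exp∘T_iα∘log on log(D − c); 1/z, z², √z = exp∘(c·)∘log on Jordan domains compactly inside their slit
regions; radial Loewner chains with piecewise-constant driving approximate any Riemann map ψ locally
uniformly on the open disc by such words g_N univalent on 𝔻; Φ_N(z) = g_N(r_N z) → ψ uniformly on
the closed disc by Carathéodory continuity (tree); DC + pushforward continuity give ψ ∈ 𝒢; g =
ψ'∘ψ⁻¹. [difficulty: L] -/
@[route_item "route-CriticalPhenomena-SAWExpCovariance", crux]
def DensityTheorem : Prop :=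
  ∀ P : Literature.Probability.RandomPlanarGeometry.ChordalFamily, P.IsChordal → (∀ (D D' : Literature.Probability.RandomPlanarGeometry.DobrushinDomain), D.carrier = D'.carrier → D.pt 0 = D'.pt 0 → D.pt 1 = D'.pt 1 → P D = P D') → (∀ (D : Literature.Probability.RandomPlanarGeometry.DobrushinDomain) (r : ℝ) (hr : 0 < r) (w : ℂ), P (D.map (Literature.Probability.RandomPlanarGeometry.similarity (r : ℂ) (Complex.ofReal_ne_zero.mpr hr.ne') w)) = (P D).map (Literature.Probability.RandomPlanarGeometry.CurveClass.map (Literature.Probability.RandomPlanarGeometry.similarity (r : ℂ) (Complex.ofReal_ne_zero.mpr hr.ne') w : C(ℂ, ℂ)))) → (∀ (U V : Literature.Probability.RandomPlanarGeometry.DobrushinDomain), Set.InjOn Complex.exp (closure U.carrier) → V.carrier = Complex.exp '' U.carrier → V.pt 0 = Complex.exp (U.pt 0) → V.pt 1 = Complex.exp (U.pt 1) → P V = (P U).map (Literature.Probability.RandomPlanarGeometry.CurveClass.map (⟨Complex.exp, Complex.continuous_exp⟩ : C(ℂ, ℂ)))) → (∀ (Dn : ℕ → Literature.Probability.RandomPlanarGeometry.DobrushinDomain)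 (D : Literature.Probability.RandomPlanarGeometry.DobrushinDomain) (Φn : ℕ → C(ℂ, ℂ)) (Φ : C(ℂ, ℂ)), (∀ n, ∃ g : Literature.Probability.RandomPlanarGeometry.ConformalEquiv (Metric.ball (0 : ℂ) 1) (Dn n).carrier, Set.EqOn (Φn n) g (Metric.ball (0 : ℂ) 1)) → (∃ g : Literature.Probability.RandomPlanarGeometry.ConformalEquiv (Metric.ball (0 : ℂ) 1) D.carrier, Set.EqOn Φ g (Metric.ball (0 : ℂ) 1)) → (∀ n, (Dn n).pt 0 = Φn n (-1) ∧ (Dn n).pt 1 = Φn n 1) → D.pt 0 = Φ (-1) → D.pt 1 = Φ 1 → TendstoUniformlyOn (fun n => ((Φn n : C(ℂ, ℂ)) : ℂ → ℂ)) (Φ : ℂ → ℂ) Filter.atTop (Metric.closedBall (0 : ℂ) 1) → ∀ f : BoundedContinuousFunction (Literature.Probability.RandomPlanarGeometry.CurveClass ℂ) ℝ, Filter.Tendsto (fun n => ∫ γ, f γ ∂(P (Dn n))) Filter.atTop (nhds (∫ γ, f γ ∂(P D)))) → P.IsConformallyCovariant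

/-- item stmt-CriticalPhenomena-6757 · crux · rank 5 · open · by planner
why it might fail: Restriction passage needs null touching of ∂D' by the limit; simplicity and boundary avoidance of SAW subsequential limits need no-crawling estimates at x_c that are not in print (only believed via SLE_8/3).
sources: LawlerSchrammWerner2004SAW, DuminilCopinHammond2013, KennedyLawler2013, Werner2007
[crux] AX: every scaling-limit family P of the critical δℤ² SAW has the two-sided restriction
property (`ChordalFamily.IsRestriction`; exact lattice identity LSW04 §3.4.5 passed to the limit),
is covariant under z ↦ r z + w (r > 0, w ∈ ℂ: (λΩ)_δ = λΩ_(δ/λ) and axis-parallel lattice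
translations along δ_n = |w|/n, exact for the FULL limit), and is carried by simple chords meeting
∂D only at a, b. A sub-bundle of AxiomsOfLimit of route SAWRestrictionRigidity (no Markov, no
reversal, no D4 needed here). [deps: LimitExists] [difficulty: open-problem] -/
@[route_item "route-CriticalPhenomena-SAWExpCovariance", crux]
def LimitAxioms : Prop :=
  ∀ P : Literature.Probability.RandomPlanarGeometry.ChordalFamily, P.IsChordal → (∀ (D : Literature.Probability.RandomPlanarGeometry.DobrushinDomain) (a b : ℝ → Literature.Probability.LatticeModels.Site 2), Literature.Probability.RandomPlanarGeometry.SAW.IsEndpointApprox D a b → Literature.Probability.RandomPlanarGeometry.TendstoLaw (fun δ (γ : Literature.Probability.RandomPlanarGeometry.SAW.DomainSAW D.carrier δ (a δ) (b δ)) => γ.curve) (fun δ => Literature.Probability.RandomPlanarGeometry.SAW.law D.carrier δ (a δ) (b δ)) id (P D)) → P.IsRestriction ∧ (∀ (D : Literature.Probability.RandomPlanarGeometry.DobrushinDomain) (r : ℝ) (hr : 0 < r) (w : ℂ), P (D.map (Literature.Probability.RandomPlanarGeometry.similarity (r : ℂ) (Complex.ofReal_ne_zero.mpr hr.ne') w))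 = (P D).map (Literature.Probability.RandomPlanarGeometry.CurveClass.map (Literature.Probability.RandomPlanarGeometry.similarity (r : ℂ) (Complex.ofReal_ne_zero.mpr hr.ne') w : C(ℂ, ℂ)))) ∧ (∀ D : Literature.Probability.RandomPlanarGeometry.DobrushinDomain, ∀ᵐ γ ∂(P D), γ ∈ Literature.Probability.RandomPlanarGeometry.CurveClass.simple ∧ γ.range ∩ frontier D.carrier ⊆ {D.pt 0, D.pt 1})

/-- item stmt-CriticalPhenomena-1371 · crux · rank 6 · open · by planner
why it might fail: Eventual tightness of the critical SAW is open (no annulus-crossing bound at x_c); uniqueness of subsequential limits is a further scalar input; an approximation-dependent limit would refute the conjunct itself.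
sources: LawlerSchrammWerner2004SAW, KemppainenSmirnov2017, AizenmanBurchardDuke1999, DuminilCopinHammond2013
[crux] existence of the full scaling limit of the critical δℤ² SAW as a chordal curve family: ∃ P,
P.IsChordal ∧ (lim) for every Dobrushin domain and every endpoint approximation (the limit is NOT
identified here). Planned glued split (tenure): EventualTight ∧ simple boundary-avoiding
subsequential limits; uniqueness of subsequential limits from AvoidanceCocycleLimit +
AvoidanceDeterminesLaw; diagonal extraction over a countable dense class of domains. Sources:
LawlerSchrammWerner2004SAW (arXiv:math/0204277 p.3 'we do not know how to prove the existence of the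
limit'), KemppainenSmirnov2017 (arXiv:1212.6215 Thm 1.5), AizenmanBurchardDuke1999,
DuminilCopinHammond2013 (arXiv:1205.0401). -/
@[route_item "route-CriticalPhenomena-SAWExpCovariance", crux]
def LimitExists : Prop :=
  ∃ P : Literature.Probability.RandomPlanarGeometry.ChordalFamily, P.IsChordal ∧ (∀ (D : Literature.Probability.RandomPlanarGeometry.DobrushinDomain) (a b : ℝ → Literature.Probability.LatticeModels.Site 2), Literature.Probability.RandomPlanarGeometry.SAW.IsEndpointApprox D a b → Literature.Probability.RandomPlanarGeometry.TendstoLaw (fun δ (γ : Literature.Probability.RandomPlanarGeometry.SAW.DomainSAW D.carrier δ (a δ) (b δ)) => γ.curve) (fun δ => Literature.Probability.RandomPlanarGeometry.SAW.law D.carrier δ (a δ) (b δ)) id (P D))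

/-- item stmt-CriticalPhenomena-3017 · support · rank 9 · closed · proved by Summit.CriticalPhenomena.SAWScalingLimit.Theorems.LSWSimpleRestrictionIsSLE_proof @ db6b0749abc7 (prover) · by planner
sources: LawlerSchrammWerner2003Restriction, arXiv:math/0209343
[support] LSW03 classification in HYPOTHESIS-FREE form (route repair 2026-08-15; implies the shared
item stmt-CriticalPhenomena-0775 = LSWRestrictionFact verbatim, see planner Sketch.lean
`lsw_new_implies_old`): a chordal family on Dobrushin domains that is chordal, conformally covariant
(ChordalFamily.IsConformallyCovariant), has the two-sided restriction property
(ChordalFamily.IsRestriction) and is carried by simple curves meeting ∂D only at the two marked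
points is, in every domain, the chordal SLE_{8/3} law (IsSLELaw (8/3)). The named-fact hypotheses of
stmt-0775 are dropped because they are not needed at κ = 8/3: existence is the library THEOREM
Literature.Probability.RandomPlanarGeometry.exists_isSLECurve_eightThirds (SLEExistenceNeEightHolds;
Rohde–Schramm Thm 5.1 + Thm 7.1; axiom closure propext/choice/Quot.sound checked), uniqueness in law
is IsSLECurve.map_eq_holds (SLEUniquenessInLaw); `exists_isSLECurve` for ALL κ is equivalent to the
unproved SLE₈ trace theorem (hasSLETrace_eight, SLETransienceIffTrace) and must not burden an
SLE_{8/3} route. Sources: LawlerSchrammWerner2003Restriction (arXiv:math/0209343: p.5 results 1–2,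
Prop. 3.3, Thm 6.1, Cor. 8.6), RohdeSchramm20 -/
@[route_item "route-CriticalPhenomena-SAWExpCovariance", crux]
def LSWRestrictionFact83 : Prop :=
  ∀ P : Literature.Probability.RandomPlanarGeometry.ChordalFamily, P.IsChordal → P.IsConformallyCovariant → P.IsRestriction → (∀ D : Literature.Probability.RandomPlanarGeometry.DobrushinDomain, ∀ᵐ γ ∂(P D), γ ∈ Literature.Probability.RandomPlanarGeometry.CurveClass.simple ∧ γ.range ∩ frontier D.carrier ⊆ {D.pt 0, D.pt 1}) → ∀ D : Literature.Probability.RandomPlanarGeometry.DobrushinDomain, Literature.Probability.RandomPlanarGeometry.IsSLELaw ((8 : NNReal) / 3) D (P D)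

/-- item stmt-CriticalPhenomena-6758 · support · rank 9 · closed · proved by Summit.CriticalPhenomena.SAWScalingLimit.Theorems.sawExpCovariance_carrierDependence_proof (prover) · by planner
sources: LawlerSchrammWerner2004SAW
[support] glue, provable now: a scaling-limit family P (chordal with (lim)) sees a Dobrushin domain
only through (carrier, a, b) — the boundary parametrisation is invisible to the lattice model.
Closes by citing `SAW.IsScalingLimitFamily.apply_eq_of_carrier_eq` (SAWScalingLimitFamily.lean,
proved: weak limits along 𝓝[>]0 are unique and endpoint approximations exist) once that module is
built on the farm; inlined here to keep the route file's import cone built. [difficulty: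
provable-now] -/
@[route_item "route-CriticalPhenomena-SAWExpCovariance", crux]
def CarrierDependence : Prop :=
  ∀ P : Literature.Probability.RandomPlanarGeometry.ChordalFamily, P.IsChordal → (∀ (D : Literature.Probability.RandomPlanarGeometry.DobrushinDomain) (a b : ℝ → Literature.Probability.LatticeModels.Site 2), Literature.Probability.RandomPlanarGeometry.SAW.IsEndpointApprox D a b → Literature.Probability.RandomPlanarGeometry.TendstoLaw (fun δ (γ : Literature.Probability.RandomPlanarGeometry.SAW.DomainSAW D.carrier δ (a δ) (b δ)) => γ.curve) (fun δ => Literature.Probability.RandomPlanarGeometry.SAW.law D.carrier δ (a δ) (b δ)) id (P D)) → ∀ (D D' : Literature.Probability.RandomPlanarGeometry.DobrushinDomain), D.carrier = D'.carrier → D.pt 0 = D'.pt 0 → D.pt 1 = D'.pt 1 → P D = P D'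

/-- item stmt-CriticalPhenomena-6759 · support · rank 9 · closed · proved by Summit.CriticalPhenomena.SAWScalingLimit.Theorems.rotationsFromExp_proof (prover) · by planner
sources: Beffara2008Universal, Cardy1984
[support] the first and most wanted step of DENS in isolation, provable now: chordal +
carrier-determined + translation/dilation covariant + exp-covariant ⇒ covariant under ALL
similarities z ↦ c z + w, c ∈ ℂ* (`ChordalFamily.IsSimilarityCovariant`): with c ≪ 0 real so that D
− c lies in the right half-plane, R_α = T_c ∘ exp ∘ T_iα ∘ Log ∘ T_(−c) on D (principal Log; both
exp steps injective on closures since heights < π), other centres by R^c_α = T_w ∘ R_α. "Rotations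
are vertical translations of the rectangle." [difficulty: provable-now] -/
@[route_item "route-CriticalPhenomena-SAWExpCovariance"]
def RotationsFromExp : Prop :=
  ∀ P : Literature.Probability.RandomPlanarGeometry.ChordalFamily, P.IsChordal → (∀ (D D' : Literature.Probability.RandomPlanarGeometry.DobrushinDomain), D.carrier = D'.carrier → D.pt 0 = D'.pt 0 → D.pt 1 = D'.pt 1 → P D = P D') → (∀ (D : Literature.Probability.RandomPlanarGeometry.DobrushinDomain) (r : ℝ) (hr : 0 < r) (w : ℂ), P (D.map (Literature.Probability.RandomPlanarGeometry.similarity (r : ℂ) (Complex.ofReal_ne_zero.mpr hr.ne') w)) = (P D).map (Literature.Probability.RandomPlanarGeometry.CurveClass.map (Literature.Probability.RandomPlanarGeometry.similarity (r : ℂ) (Complex.ofReal_ne_zero.mpr hr.ne') w : C(ℂ, ℂ)))) → (∀ (U V : Literature.Probability.RandomPlanarGeometry.DobrushinDomain), Set.InjOn Complex.exp (closure U.carrier) → V.carrier = Complex.exp '' U.carrier → V.pt 0 = Complex.exp (U.pt 0) → V.pt 1 = Complex.exp (U.pt 1) → P V = (P U).map (Literature.Probability.RandomPlanarGeometry.CurveClass.map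 (⟨Complex.exp, Complex.continuous_exp⟩ : C(ℂ, ℂ)))) → P.IsSimilarityCovariant

-- earlier Assembly (stmt-CriticalPhenomena-10578, replaced 2026-08-15T16:53:29Z -> stmt-CriticalPhenomena-11200): retired by None — ExpCovariance → DiscContinuity → DensityTheorem → LimitAxioms → LimitExists → CarrierDependence → RotationsFromExp → SAWScalingLimit
-- earlier Assembly (stmt-CriticalPhenomena-11200, replaced 2026-08-15T17:27:19Z -> stmt-CriticalPhenomena-11373): retired by None — ExpCovariance → DiscContinuity → DensityTheorem → LimitAxioms → LimitExists → CarrierDependence → RotationsFromExp → LSWRestrictionFact83 → _root_.SAWScalingLimit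
-- earlier Assembly (stmt-CriticalPhenomena-6760, replaced 2026-08-15T16:18:44Z -> stmt-CriticalPhenomena-10578): retired by None — Literature.Probability.RandomPlanarGeometry.exists_isSLECurve → Literature.Probability.RandomPlanarGeometry.IsSLECurve.map_eq → LSWRestrictionFact → DensityTheorem → CarrierDependence → LimitExists → LimitAxioms → ExpCovariance → DiscContinuity → SAWScalingLimit
/-- item stmt-CriticalPhenomena-11373 · assembly · rank 1 · closed · proved by Summit.CriticalPhenomena.SAWScalingLimit.Theorems.sawExpCovariance_assembly_proof (prover) · by planner
sources: LawlerSchrammWerner2003Restriction, LawlerSchrammWerner2004SAW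
[assembly] ExpCovariance → DiscContinuity → DensityTheorem → LimitAxioms → LimitExists →
CarrierDependence → LSWRestrictionFact83 → SAWScalingLimit — exactly the type of the deciding
theorem `closes` after the cone repair of 2026-08-15 (the LSW03 step is the shared hypothesis-free
item LSWRestrictionFact83 = stmt-CriticalPhenomena-3017; the unused support hypothesis
RotationsFromExp of rev 1–7 is dropped from the glue, not from the route); closes at once by the
term `closes`. [difficulty: provable-now] -/
@[route_item "route-CriticalPhenomena-SAWExpCovariance"]
def Assembly : Prop :=
  ExpCovariance → DiscContinuity → DensityTheorem → LimitAxioms → LimitExists → CarrierDependence → LSWRestrictionFact83 → _root_.SAWScalingLimit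

/-! D-0027 §2.1 — DECIDING THEOREM (planner-authored via `route open/edit --closes-file`; by planner-rrepair-CriticalPhenomena-SAWExpCovari-379aca35-0 2026-08-15T17:27:19Z):
its hypotheses are this route's items and its conclusion the sub-problem Statement (glue_lint), and it elaborates with this file. -/

/-- DECIDING THEOREM of route SAWExpCovariance (D-0027 §2.1; cone repair 2026-08-15).
Hypotheses = the route's own items; conclusion = the sub-problem statement
`_root_.SAWScalingLimit` by name. Logic over the tree: `LimitExists` gives the scaling-limit
family `P` (chordal with (lim)); `LimitAxioms` gives restriction, translation/dilation
covariance and simplicity; `CarrierDependence`, `ExpCovariance`, `DiscContinuity` feed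
`DensityTheorem`, which returns `P.IsConformallyCovariant`; the shared hypothesis-free LSW03
item `LSWRestrictionFact83` (stmt-CriticalPhenomena-3017, LSW03 p. 5 result 2 at κ = 8/3 —
provable now in one line by the in-tree theorem `LawlerSchrammWerner2003_holds`, whose module
is deliberately absent from this file's header so that the route's module cone stays inside the
Statement's own cone)
identifies every `P D` as the chordal SLE_{8/3} law; `integral_map` + `SAW.aemeasurable_curve`
turn (lim) into `ConvergesInLawToSLE (8/3)`. The support item `RotationsFromExp` (first step of DENS)
and the `Assembly` item are route items but not hypotheses: nothing unused is assumed. -/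
@[closes "route-CriticalPhenomena-SAWExpCovariance"] theorem closes (hEXP : ExpCovariance) (hDC : DiscContinuity) (hDENS : DensityTheorem)
    (hAX : LimitAxioms) (hLIM : LimitExists) (hCD : CarrierDependence)
    (hLSW : LSWRestrictionFact83) : _root_.SAWScalingLimit := by
  obtain ⟨P, hch, hlim⟩ := hLIM
  obtain ⟨hres, hsim, hsimple⟩ := hAX P hch hlim
  have hcc : P.IsConformallyCovariant :=
    hDENS P hch (hCD P hch hlim) hsim (hEXP P hch hlim) (hDC P hch hlim)
  have hsle : ∀ D : Literature.Probability.RandomPlanarGeometry.DobrushinDomain,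
      Literature.Probability.RandomPlanarGeometry.IsSLELaw ((8 : NNReal) / 3) D (P D) :=
    hLSW P hch hcc hres hsimple
  intro D a b hab
  obtain ⟨Γ, hΓ, hPD⟩ := hsle D
  refine ⟨Γ, hΓ, Filter.Eventually.of_forall fun δ =>
    Literature.Probability.RandomPlanarGeometry.SAW.aemeasurable_curve _ _ _ _, fun f => ?_⟩
  have h := hlim D a b hab f
  simp only [id_eq, hPD] at h
  rwa [MeasureTheory.integral_map hΓ.aemeasurable f.continuous.aestronglyMeasurable] at h

end Summit.CriticalPhenomena.SAWScalingLimit.Theses.SAWExpCovariance
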